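import Summits.QuantumFields.BalabanUV.Beta.GAN24.DressedLegEnvelope
import Summits.QuantumFields.BalabanUV.Beta.GAN24.ThreeLegFreezeBricks
import Summits.QuantumFields.BalabanUV.Beta.GAN24.StaircaseFaces

/-!
# `BalabanUV.Beta.GAN24.DressedLegBlockL1MultiplierColumn` — binder row G-an2-4 ∕ (CONV-C), W-slot, the (α-0) parity re-cut, located crux (Q-L-k₀)
# (RULING R-gan24p1-g36-1 (4)(B), part 3; the OWNER's W-3 l.53806 ↔ leaf-01 g74's W-2 l.53845 (2): «the `f = inr` part is LIVE»): **THE MULTIPLIER-COLUMN PART OF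
# THE CARRIER's COMPOSITE KERNEL LEG IS `T^B`-SIZED IN BLOCK-ℓ¹** — the dressed row chain of levels `m+1 … m+k+1` composed at its fine end with the
# multiplier–multiplier block of the level-`m` unit step kernel (OWNER `b2b-balaban-gan24-p1`, gen 36; part 3a of `GAN24/DressedLegSawtoothBlockL1` — the abstract composition; part 3b instantiates)

NOT IN PRINT; OUR BOOKKEEPING ([folklore] one composition of a block-ℓ¹ envelope with a decaying one-step kernel; 0 `def`, 0 cited facts, 0 `def … : Prop`,
0 sorry).  HONEST FRAMING (cell contract, verbatim): «discharging `BetaPertH` makes Bałaban's UV stability UNCONDITIONAL — a real constructive-QFT result; it is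
NOT the continuum limit and NOT the Clay problem.»  HONEST DEPENDENCY (verbatim): «continuum YM on T⁴ ⇐ BetaPertH ∧ nine spine estimates (0/9 proved); BetaPertH ⇐
(D1) ∧ (D4) ∧ CAP+tail; G-an2-4 gates asym, D1 and NE2/3/4.»

WHY.  leaf-01 g74's carrier (`LegStepPush` ∕ `LegChainPush`) reads the table's left kernel fibre through the FULL multiplier row `krow K N α x′ f x := K (N•x′) x (inr α) f`,
`f ∈ inl ⊕ inr`; the coarser factors of the composite `kChain` are joined through FIELD columns only (`kcomp`), so the free column fibre sits at the FINEST leg: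
(f = inl) the chain is `±legChain (respStepBmSeq ρ Lc)` — part 2 `DressedLegBlockL1Envelope`; (f = inr) it is the dressed row chain of the levels ABOVE `m` composed with
the multiplier–multiplier block of the finest kernel, which the co-dressing does not touch (§1) and which the LANDED K-slot bounds uniformly in the level
(`KSlotAssembly.convCK_holds` ⟹ `UnitDecayK`).  The members' leg letters DO have `inr` left rows (the border source is fm∕mf), so this part is live.
WHAT (generic `d`; `1 ≤ Lc`):
* §1 `coDressKBmAt_inr_inr` — `coDressKBmAt ρ N K x y (inr α) (inr β) = K x y (inr α) (inr β)`; `unitK_coDressKBmAt_inr_inr` (the same in leg units).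
* §2 geometry ∕ decay bricks: `quo_pow_succ_zsmul` (`quo (Lc^{k+2}) (Lc•x′) = quo (Lc^{k+1}) x′`), `exp_sep_le` (half a decay of rate `δK` dominates the coarse
  envelope `e^{2κ₁}·e^{−2κ₁‖quo_L u − quo_L x‖∞}` when `4κ₁ ≤ δK` — leaf-01 g74's sharp wobble `ThreeLegFreezeBricks.supNorm_quo_sub_quo_le_div`), `sum_box_exp_decay_le`
  (`Σ_{t ∈ box L} e^{−δK|u − x_t|₁} ≤ Zl(δK∕2)·e^{2κ₁}·e^{−2κ₁‖quo_L u − c‖∞}` on the block labelled `c`), `tsum_env_le` (`Σ′_{c′} e^{−κ‖c′ − c‖∞} ≤ e^{κ}·Zl(κ∕(d+1))`).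
* §3 **`sum_box_abs_comp_mm_le`** — ABSTRACT: a family `A x′` with block-ℓ¹ envelope `a·E_{κ₁}(c′)` at blocking `Lc^{k+1}` composed with a kernel `|M (Lc•x′) x| ≤ CK·e^{−δK|Lc•x′ − x|₁}`
  has block-ℓ¹ envelope `a·CK·Zl(δK∕2)·e^{3κ₁}·Zl(κ₁∕(d+1))·E_{κ₁}(c)` at blocking `Lc^{k+2}` (`4κ₁ ≤ δK`); `summable_mul_of_decay`.  THE INSTANCE (part 2's law ⨾ the K-slot's
  `UnitDecayK` ⨾ §3) is part 3b `GAN24/DressedLegMultiplierColumnEnvelope.exists_legChain_mmColumn_blockL1_envelope`.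
Asserts NOTHING about Bałaban's tables beyond the tree's K-slot; NOT (H1♮); NEVER «G-an2-4 closed» as (CONV-C); NOT D1, NOT `BetaPertH`, NOT continuum, NOT Clay.
2026-08-23; no existing file touched.
-/

noncomputable section

open Finset
open scoped BigOperators
open Literature.MathematicalPhysics.QuantumFieldTheory
open Literature.MathematicalPhysics.QuantumFieldTheory.LatticeForm (quo)
open Literature.MathematicalPhysics.QuantumFieldTheory.Balaban1983to89
open Literature.MathematicalPhysics.QuantumFieldTheory.Balaban1983to89.Beta
open B4ContourShift (supNorm supNorm_nonneg)
open B4Reflection242 (supNorm_add_le)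
open B12Sec2to5 (l1 l1_nonneg)
open ExpKernelCalculus (MKer Decays comp Zl Zl_nonneg summable_exp_shift tsum_exp_shift summable_exp_shift' tsum_exp_shift')
open OneStepResolventKernel (Fib quo_zsmul)
open AffineAveraging (Site box toSite)
open AveragingContours (blk off off_mem_box blk_add_off)
open KKTFluctuationEnergy (quo_zsmul_add_toSite tsum_blocks summable_blocks)
open Summit.QuantumFields.BalabanUV.Beta.TameKernelCalculus (trK)
open Summit.QuantumFields.BalabanUV.Beta.HessKerDressedUnits (unitK unitK_apply legScale)
open Summit.QuantumFields.BalabanUV.Beta.AxialDressingRooted (piKBm coDressKBmAt coDressKBmAt_eq comp_piKBm_inr piKBm_inl_inr piKBm_inr_inr)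
open Summit.QuantumFields.BalabanUV.Beta.GAN24.EnvelopeBlockSum (env_le_exp_l1)
open Summit.QuantumFields.BalabanUV.Beta.GAN24.StaircaseFaces (blk_one quo_quo)
open Summit.QuantumFields.BalabanUV.Beta.GAN24.ThreeLegFreezeBricks (supNorm_quo_sub_quo_le_div)

namespace Summit.QuantumFields.BalabanUV.Beta.GAN24.DressedLegBlockL1MultiplierColumn

variable {d : ℕ}

/-! ## §1 The co-dressing does not touch the multiplier–multiplier block -/

/-- [folklore] **THE MULTIPLIER–MULTIPLIER BLOCK OF THE CO-DRESSED KERNEL IS THE KERNEL's OWN**: `coDressKBmAt ρ N K x y (inr α) (inr β) = K x y (inr α) (inr β)`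
(`coDressKBmAt = Πᵀ ∘ K ∘ Π`; `Π`'s multiplier columns and rows are the identity: `comp_piKBm_inr` on the right, `piKBm_inl_inr` ∕ `piKBm_inr_inr` on the left). -/
theorem coDressKBmAt_inr_inr (ρ : Fin (d + 1) → ℤ) (N : ℕ) (K : MKer (d + 1) (Fib d)) (x y : Fin (d + 1) → ℤ) (α β : Fin (d + 1)) :
    coDressKBmAt ρ N K x y (Sum.inr α) (Sum.inr β) = K x y (Sum.inr α) (Sum.inr β) := by
  rw [coDressKBmAt_eq, comp_piKBm_inr]
  unfold ExpKernelCalculus.comp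
  have h : ∀ z, ∑ f : Fib d, trK (piKBm ρ N) x z (Sum.inr α) f * K z y f (Sum.inr β)
      = if z = x then K z y (Sum.inr α) (Sum.inr β) else 0 := by
    intro z
    rw [Fintype.sum_sum_type]
    simp only [trK, piKBm_inl_inr, zero_mul, Finset.sum_const_zero, zero_add, piKBm_inr_inr]
    by_cases hz : z = x
    · subst hz
      simp only [true_and, ite_mul, one_mul, zero_mul, Finset.sum_ite_eq', Finset.mem_univ, if_true]
    · simp [hz]
  simp_rw [h]
  rw [tsum_ite_eq]

/-- [folklore] … and in leg units: `unitK sf sm (coDressKBmAt ρ N K) x y (inr α) (inr β) = unitK sf sm K x y (inr α) (inr β)`. -/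
theorem unitK_coDressKBmAt_inr_inr (sf sm : ℝ) (ρ : Fin (d + 1) → ℤ) (N : ℕ) (K : MKer (d + 1) (Fib d)) (x y : Fin (d + 1) → ℤ) (α β : Fin (d + 1)) :
    unitK sf sm (coDressKBmAt ρ N K) x y (Sum.inr α) (Sum.inr β) = unitK sf sm K x y (Sum.inr α) (Sum.inr β) := by
  rw [unitK_apply, unitK_apply, coDressKBmAt_inr_inr]

/-! ## §2 Geometry and decay bricks -/

/-- [folklore] One blocking step up: `quo (Lc^{k+2}) (Lc•x′) = quo (Lc^{k+1}) x′`. -/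
theorem quo_pow_succ_zsmul {Lc : ℕ} [NeZero Lc] (k : ℕ) (x' : Fin (d + 1) → ℤ) :
    quo (Lc ^ (k + 2)) ((Lc : ℤ) • x') = quo (Lc ^ (k + 1)) x' := by
  have h := quo_quo (d := d) Lc (Lc ^ (k + 1)) ((Lc : ℤ) • x')
  rw [quo_zsmul] at h
  rw [h, show Lc * Lc ^ (k + 1) = Lc ^ (k + 2) by ring]

/-- [folklore] **HALF A DECAY DOMINATES THE COARSE ENVELOPE**: for `1 ≤ L`, `0 ≤ κ₁`, `4κ₁ ≤ δK`:
`e^{−(δK∕2)|u − x|₁} ≤ e^{2κ₁}·e^{−2κ₁‖quo_L u − quo_L x‖∞}` (leaf-01 g74's sharp wobble `‖quo_L u − quo_L x‖∞ ≤ |u − x|₁∕L + 1`). -/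
theorem exp_sep_le {L : ℕ} (hL : 1 ≤ L) {κ₁ δK : ℝ} (hκ : 0 ≤ κ₁) (h4 : 4 * κ₁ ≤ δK) (u x : Fin (d + 1) → ℤ) :
    Real.exp (-(δK / 2) * l1 (u - x)) ≤ Real.exp (2 * κ₁) * Real.exp (-(2 * κ₁) * supNorm (quo L u - quo L x)) := by
  rw [← Real.exp_add, Real.exp_le_exp]
  have hw := supNorm_quo_sub_quo_le_div (d := d) hL u x
  have hLr : (1 : ℝ) ≤ L := by exact_mod_cast hL
  have hl : 0 ≤ l1 (u - x) := l1_nonneg _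
  have h1 : l1 (u - x) / (L : ℝ) ≤ l1 (u - x) := div_le_self hl hLr
  nlinarith [mul_le_mul_of_nonneg_left (hw.trans (by linarith : l1 (u - x) / (L : ℝ) + 1 ≤ l1 (u - x) + 1)) (by linarith : (0:ℝ) ≤ 2 * κ₁)]

/-- [folklore] **THE BLOCK SUM OF A DECAYING KERNEL ROW, WITH BLOCK SEPARATION**: for the points `x_t = L•c + t` of the block labelled `c`,
`Σ_{t ∈ box L} e^{−δK|u − x_t|₁} ≤ Zl(δK∕2)·e^{2κ₁}·e^{−2κ₁‖quo_L u − c‖∞}` (`0 < δK`, `0 ≤ κ₁`, `4κ₁ ≤ δK`). -/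
theorem sum_box_exp_decay_le {L : ℕ} (hL : 1 ≤ L) {κ₁ δK : ℝ} (hκ : 0 ≤ κ₁) (hδK : 0 < δK) (h4 : 4 * κ₁ ≤ δK)
    (u c : Fin (d + 1) → ℤ) :
    ∑ t ∈ box (d + 1) L, Real.exp (-δK * l1 (u - ((L : ℤ) • c + toSite t)))
      ≤ Zl (d + 1) (δK / 2) * Real.exp (2 * κ₁) * Real.exp (-(2 * κ₁) * supNorm (quo L u - c)) := by
  haveI : NeZero L := ⟨by omega⟩
  have hδ2 : 0 < δK / 2 := by positivity
  -- pointwise: split the decay in two halves, the second dominates the coarse envelope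
  have hpt : ∀ t ∈ box (d + 1) L, Real.exp (-δK * l1 (u - ((L : ℤ) • c + toSite t)))
      ≤ Real.exp (-(δK / 2) * l1 (u - ((L : ℤ) • c + toSite t))) *
          (Real.exp (2 * κ₁) * Real.exp (-(2 * κ₁) * supNorm (quo L u - c))) := by
    intro t ht
    have hs := exp_sep_le (d := d) hL hκ h4 u ((L : ℤ) • c + toSite t)
    rw [quo_zsmul_add_toSite c ht] at hs
    have e : Real.exp (-δK * l1 (u - ((L : ℤ) • c + toSite t)))
        = Real.exp (-(δK / 2) * l1 (u - ((L : ℤ) • c + toSite t))) * Real.exp (-(δK / 2) * l1 (u - ((L : ℤ) • c + toSite t))) := by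
      rw [← Real.exp_add]; congr 1; ring
    rw [e]
    exact mul_le_mul_of_nonneg_left hs (Real.exp_pos _).le
  refine (Finset.sum_le_sum hpt).trans ?_
  rw [← Finset.sum_mul, mul_assoc (Zl (d + 1) (δK / 2))]
  refine mul_le_mul_of_nonneg_right ?_ (by positivity)
  -- the finite half-decay sum is at most the full lattice sum `Zl(δK/2)`
  have hinj : ∀ t ∈ box (d + 1) L, ∀ t' ∈ box (d + 1) L,
      (L : ℤ) • c + toSite t = (L : ℤ) • c + toSite t' → t = t' := by
    intro t _ t' _ h
    have h' : toSite t = toSite t' := add_left_cancel h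
    funext i
    have := congrArg (fun f => f i) h'
    simpa [toSite] using this
  rw [← Finset.sum_image (f := fun x => Real.exp (-(δK / 2) * l1 (u - x))) hinj]
  calc ∑ x ∈ (box (d + 1) L).image (fun t => (L : ℤ) • c + toSite t), Real.exp (-(δK / 2) * l1 (u - x))
      ≤ ∑' x, Real.exp (-(δK / 2) * l1 (u - x)) :=
        (summable_exp_shift hδ2 u).sum_le_tsum _ (fun x _ => (Real.exp_pos _).le)
    _ = Zl (d + 1) (δK / 2) := tsum_exp_shift u

/-- [folklore] The coarse sup-norm envelope is summable with `Σ′_{c′} e^{−κ‖c′ − c‖∞} ≤ e^{κ}·Zl(κ∕(d+1))` (`EnvelopeBlockSum.env_le_exp_l1` at blocking `1`). -/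
theorem tsum_env_le {κ : ℝ} (hκ : 0 < κ) (c : Fin (d + 1) → ℤ) :
    (Summable fun c' : Fin (d + 1) → ℤ => Real.exp (-(κ * supNorm (c' - c)))) ∧
      ∑' c' : Fin (d + 1) → ℤ, Real.exp (-(κ * supNorm (c' - c))) ≤ Real.exp κ * Zl (d + 1) (κ / ((d : ℝ) + 1)) := by
  have hr : 0 < κ / (((d : ℝ) + 1) * (1 : ℕ)) := by positivity
  have hpt : ∀ c' : Fin (d + 1) → ℤ, Real.exp (-(κ * supNorm (c' - c)))
      ≤ Real.exp κ * Real.exp (-(κ / (((d : ℝ) + 1) * (1 : ℕ))) * l1 (c' - ((1 : ℕ) : ℤ) • c)) := by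
    intro c'
    have h := env_le_exp_l1 (d := d) (L := 1) le_rfl hκ.le c c'
    have hq : quo 1 c' = c' := blk_one c'
    rw [hq] at h
    exact h
  have hs := (summable_exp_shift' hr (((1 : ℕ) : ℤ) • c)).mul_left (Real.exp κ)
  have hsum : Summable fun c' : Fin (d + 1) → ℤ => Real.exp (-(κ * supNorm (c' - c))) :=
    Summable.of_nonneg_of_le (fun _ => (Real.exp_pos _).le) hpt hs
  refine ⟨hsum, ?_⟩
  calc ∑' c' : Fin (d + 1) → ℤ, Real.exp (-(κ * supNorm (c' - c)))
      ≤ ∑' c' : Fin (d + 1) → ℤ, Real.exp κ * Real.exp (-(κ / (((d : ℝ) + 1) * (1 : ℕ))) * l1 (c' - ((1 : ℕ) : ℤ) • c)) :=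
        hsum.tsum_le_tsum hpt hs
    _ = Real.exp κ * Zl (d + 1) (κ / ((d : ℝ) + 1)) := by
        rw [tsum_mul_left, tsum_exp_shift']; simp only [Nat.cast_one, mul_one]

/-! ## §3 The composition: block-ℓ¹ envelope ∘ decaying one-step kernel -/


/-- [folklore] A bounded family against a kernel decaying from the dilated point is summable in the middle variable. -/
theorem summable_mul_of_decay {Lc : ℕ} (hLc : 1 ≤ Lc) {a CK δK : ℝ} (hδK : 0 < δK) (ha : 0 ≤ a) (hCK : 0 ≤ CK)
    {A : (Fin (d + 1) → ℤ) → ℝ} {M : (Fin (d + 1) → ℤ) → (Fin (d + 1) → ℤ) → ℝ} (hAb : ∀ x', |A x'| ≤ a)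
    (hM : ∀ x' x, |M x' x| ≤ CK * Real.exp (-δK * l1 ((Lc : ℤ) • x' - x))) (x : Fin (d + 1) → ℤ) :
    Summable fun x' => A x' * M x' x := by
  have hb : ∀ x', ‖A x' * M x' x‖ ≤ (a * CK * Real.exp (δK * l1 x)) * Real.exp (-δK * l1 (x' - 0)) := by
    intro x'
    rw [Real.norm_eq_abs, abs_mul]
    have h2 := hM x' x
    -- `|Lc•x' − x|₁ ≥ |x'|₁ − |x|₁`
    have hl : l1 (x' - 0) - l1 x ≤ l1 ((Lc : ℤ) • x' - x) := by
      unfold l1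
      rw [sub_zero, ← Finset.sum_sub_distrib]
      refine Finset.sum_le_sum fun i _ => ?_
      simp only [Pi.sub_apply, Pi.smul_apply, smul_eq_mul, Int.cast_sub, Int.cast_mul, Int.cast_natCast]
      have hL0 : (1 : ℝ) ≤ Lc := by exact_mod_cast hLc
      have := abs_sub_abs_le_abs_sub ((Lc : ℝ) * (x' i : ℝ)) (x i : ℝ)
      have h3 : |(x' i : ℝ)| ≤ |(Lc : ℝ) * (x' i : ℝ)| := by
        rw [abs_mul, abs_of_nonneg (by positivity : (0:ℝ) ≤ Lc)]; nlinarith [abs_nonneg (x' i : ℝ)]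
      linarith
    have h3 : Real.exp (-δK * l1 ((Lc : ℤ) • x' - x)) ≤ Real.exp (δK * l1 x) * Real.exp (-δK * l1 (x' - 0)) := by
      rw [← Real.exp_add, Real.exp_le_exp]; nlinarith
    calc |A x'| * |M x' x| ≤ a * (CK * Real.exp (-δK * l1 ((Lc : ℤ) • x' - x))) :=
          mul_le_mul (hAb x') h2 (abs_nonneg _) ha
      _ ≤ a * (CK * (Real.exp (δK * l1 x) * Real.exp (-δK * l1 (x' - 0)))) :=
          mul_le_mul_of_nonneg_left (mul_le_mul_of_nonneg_left h3 hCK) ha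
      _ = _ := by ring
  exact Summable.of_norm_bounded ((summable_exp_shift' hδK 0).mul_left _) hb

/-- NOT IN PRINT; OUR BOOKKEEPING.  **BLOCK-ℓ¹ ∘ DECAYING KERNEL IS BLOCK-ℓ¹, ONE BLOCKING UP** (abstract; `1 ≤ Lc`): a family `A : Site → ℝ` with block mass
`Σ_{s ∈ box (Lc^{k+1})} |A (Lc^{k+1}•c′ + s)| ≤ a·e^{−κ₁‖c′ − z‖∞}` for every label `c′`, composed with a kernel `M` with `|M x′ x| ≤ CK·e^{−δK|Lc•x′ − x|₁}` (`4κ₁ ≤ δK`), gives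
`Σ_{t ∈ box (Lc^{k+2})} |Σ′_{x′} A x′ · M x′ (Lc^{k+2}•c + t)| ≤ a·CK·Zl(δK∕2)·e^{3κ₁}·Zl(κ₁∕(d+1))·e^{−κ₁‖c − z‖∞}`. -/
theorem sum_box_abs_comp_mm_le {Lc : ℕ} (hLc : 1 ≤ Lc) (k : ℕ) {κ₁ δK a CK : ℝ} (hκ : 0 < κ₁) (hδK : 0 < δK) (h4 : 4 * κ₁ ≤ δK)
    (ha : 0 ≤ a) (hCK : 0 ≤ CK) {A : (Fin (d + 1) → ℤ) → ℝ} {M : (Fin (d + 1) → ℤ) → (Fin (d + 1) → ℤ) → ℝ} (z : Fin (d + 1) → ℤ)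
    (hA : ∀ c', ∑ s ∈ box (d + 1) (Lc ^ (k + 1)), |A (((Lc ^ (k + 1) : ℕ) : ℤ) • c' + toSite s)| ≤ a * Real.exp (-(κ₁ * supNorm (c' - z))))
    (hM : ∀ x' x, |M x' x| ≤ CK * Real.exp (-δK * l1 ((Lc : ℤ) • x' - x))) (c : Fin (d + 1) → ℤ) :
    ∑ t ∈ box (d + 1) (Lc ^ (k + 2)), |∑' x', A x' * M x' (((Lc ^ (k + 2) : ℕ) : ℤ) • c + toSite t)|
      ≤ a * CK * Zl (d + 1) (δK / 2) * Real.exp (3 * κ₁) * Zl (d + 1) (κ₁ / ((d : ℝ) + 1)) * Real.exp (-(κ₁ * supNorm (c - z))) := by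
  classical
  haveI : NeZero Lc := ⟨by omega⟩
  haveI : NeZero (Lc ^ (k + 1)) := ⟨pow_ne_zero _ (NeZero.ne Lc)⟩
  have hL1 : 1 ≤ Lc ^ (k + 1) := Nat.one_le_pow _ _ hLc
  have hL2 : 1 ≤ Lc ^ (k + 2) := Nat.one_le_pow _ _ hLc
  set E : (Fin (d + 1) → ℤ) → ℝ := fun c' => Real.exp (-(κ₁ * supNorm (c' - z))) with hE
  set G : (Fin (d + 1) → ℤ) → ℝ := fun c' => Real.exp (-(2 * κ₁) * supNorm (c' - c)) with hG
  set Z₂ : ℝ := Zl (d + 1) (δK / 2) * Real.exp (2 * κ₁) with hZ₂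
  have hZ₂0 : 0 ≤ Z₂ := by rw [hZ₂]; have := Zl_nonneg (D := d + 1) (show 0 < δK / 2 by positivity); positivity
  -- pointwise domination of `A` by its block mass: `|A x'| ≤ a · E (quo (Lc ^ (k + 1)) x')`
  have hAx : ∀ x', |A x'| ≤ a * E (quo (Lc ^ (k + 1)) x') := by
    intro x'
    have hx : A x' = A (((Lc ^ (k + 1) : ℕ) : ℤ) • blk (Lc ^ (k + 1)) x' + toSite (off (Lc ^ (k + 1)) x')) := by rw [blk_add_off hL1 x']
    have h1 : |A x'| ≤ ∑ s ∈ box (d + 1) (Lc ^ (k + 1)), |A (((Lc ^ (k + 1) : ℕ) : ℤ) • blk (Lc ^ (k + 1)) x' + toSite s)| := by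
      rw [hx]
      exact Finset.single_le_sum (f := fun s => |A (((Lc ^ (k + 1) : ℕ) : ℤ) • blk (Lc ^ (k + 1)) x' + toSite s)|) (fun _ _ => abs_nonneg _) (off_mem_box hL1 x')
    exact h1.trans (hA (blk (Lc ^ (k + 1)) x'))
  -- the block sums of `|M x' ·|` with block separation
  have hMsum : ∀ x', ∑ t ∈ box (d + 1) (Lc ^ (k + 2)), |M x' (((Lc ^ (k + 2) : ℕ) : ℤ) • c + toSite t)| ≤ CK * Z₂ * G (quo (Lc ^ (k + 1)) x') := by
    intro x'
    have h := sum_box_exp_decay_le (d := d) hL2 hκ.le hδK h4 ((Lc : ℤ) • x') c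
    rw [quo_pow_succ_zsmul] at h
    calc ∑ t ∈ box (d + 1) (Lc ^ (k + 2)), |M x' (((Lc ^ (k + 2) : ℕ) : ℤ) • c + toSite t)|
        ≤ ∑ t ∈ box (d + 1) (Lc ^ (k + 2)), CK * Real.exp (-δK * l1 ((Lc : ℤ) • x' - (((Lc ^ (k + 2) : ℕ) : ℤ) • c + toSite t))) :=
          Finset.sum_le_sum fun t _ => hM x' _
      _ = CK * ∑ t ∈ box (d + 1) (Lc ^ (k + 2)), Real.exp (-δK * l1 ((Lc : ℤ) • x' - (((Lc ^ (k + 2) : ℕ) : ℤ) • c + toSite t))) := by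
          rw [Finset.mul_sum]
      _ ≤ CK * (Zl (d + 1) (δK / 2) * Real.exp (2 * κ₁) * Real.exp (-(2 * κ₁) * supNorm (quo (Lc ^ (k + 1)) x' - c))) :=
          mul_le_mul_of_nonneg_left (by push_cast at h ⊢; exact h) hCK
      _ = CK * Z₂ * G (quo (Lc ^ (k + 1)) x') := by rw [hZ₂, hG]; ring
  -- summability of the summand in `x'` for each `t` (bounded `A`, decaying `M`)
  have hAb : ∀ x', |A x'| ≤ a := fun x' => (hAx x').trans (by
    have : E (quo (Lc ^ (k + 1)) x') ≤ 1 := by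
      rw [hE]; simp only; rw [Real.exp_le_one_iff]; have := supNorm_nonneg (quo (Lc ^ (k + 1)) x' - z); nlinarith
    nlinarith)
  have hsumm : ∀ x : Fin (d + 1) → ℤ, Summable fun x' => A x' * M x' x := summable_mul_of_decay (d := d) hLc hδK ha hCK hAb hM
  -- step 1: triangle inequality and the swap of the finite block sum with the `x'`-series
  have hstep : ∑ t ∈ box (d + 1) (Lc ^ (k + 2)), |∑' x', A x' * M x' (((Lc ^ (k + 2) : ℕ) : ℤ) • c + toSite t)|
      ≤ ∑' x', |A x'| * ∑ t ∈ box (d + 1) (Lc ^ (k + 2)), |M x' (((Lc ^ (k + 2) : ℕ) : ℤ) • c + toSite t)| := by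
    have hsa : ∀ t ∈ box (d + 1) (Lc ^ (k + 2)), Summable fun x' => |A x'| * |M x' (((Lc ^ (k + 2) : ℕ) : ℤ) • c + toSite t)| := by
      intro t _
      have := (hsumm (((Lc ^ (k + 2) : ℕ) : ℤ) • c + toSite t)).abs
      exact this.congr fun x' => by rw [abs_mul]
    calc ∑ t ∈ box (d + 1) (Lc ^ (k + 2)), |∑' x', A x' * M x' (((Lc ^ (k + 2) : ℕ) : ℤ) • c + toSite t)|
        ≤ ∑ t ∈ box (d + 1) (Lc ^ (k + 2)), ∑' x', |A x'| * |M x' (((Lc ^ (k + 2) : ℕ) : ℤ) • c + toSite t)| :=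
          Finset.sum_le_sum fun t ht => by
            have h1 := norm_tsum_le_tsum_norm ((hsumm (((Lc ^ (k + 2) : ℕ) : ℤ) • c + toSite t)).norm)
            rw [Real.norm_eq_abs] at h1
            refine h1.trans (le_of_eq (tsum_congr fun x' => ?_))
            rw [Real.norm_eq_abs, abs_mul]
      _ = ∑' x', ∑ t ∈ box (d + 1) (Lc ^ (k + 2)), |A x'| * |M x' (((Lc ^ (k + 2) : ℕ) : ℤ) • c + toSite t)| :=
          (Summable.tsum_finsetSum hsa).symm
      _ = ∑' x', |A x'| * ∑ t ∈ box (d + 1) (Lc ^ (k + 2)), |M x' (((Lc ^ (k + 2) : ℕ) : ℤ) • c + toSite t)| :=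
          tsum_congr fun x' => by rw [Finset.mul_sum]
  -- step 2: bound the inner block sums, regroup `x'` by blocks, consume the block mass of `A`
  have hEnv := tsum_env_le (d := d) hκ c
  have hGsum : Summable fun c' : Fin (d + 1) → ℤ => G c' := by
    have h2 := tsum_env_le (d := d) (show 0 < 2 * κ₁ by positivity) c
    refine h2.1.congr fun c' => ?_
    rw [hG]; simp only [neg_mul]
  -- the majorant series `x' ↦ a·E(quo (Lc ^ (k + 1)) x')·CK·Z₂·G(quo (Lc ^ (k + 1)) x')` is summable (block-constant, summable over blocks)
  have hdom : ∀ x', ‖|A x'| * ∑ t ∈ box (d + 1) (Lc ^ (k + 2)), |M x' (((Lc ^ (k + 2) : ℕ) : ℤ) • c + toSite t)|‖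
      ≤ |A x'| * (CK * Z₂ * G (quo (Lc ^ (k + 1)) x')) := by
    intro x'
    rw [Real.norm_eq_abs, abs_of_nonneg (mul_nonneg (abs_nonneg _) (Finset.sum_nonneg fun _ _ => abs_nonneg _))]
    exact mul_le_mul_of_nonneg_left (hMsum x') (abs_nonneg _)
  -- summability of `x' ↦ |A x'| * (CK Z₂ G(quo (Lc ^ (k + 1)) x'))`: dominated by `a E(quo x') CK Z₂ G(quo x')`, itself by a constant times `G ∘ quo`
  have hGq : Summable fun x' : Fin (d + 1) → ℤ => G (quo (Lc ^ (k + 1)) x') := by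
    -- `G ∘ quo N` summable: re-block
    have hb : ∀ x', ‖G (quo (Lc ^ (k + 1)) x')‖ ≤ Real.exp (2 * κ₁) * Real.exp (-((2 * κ₁) / (((d : ℝ) + 1) * (Lc ^ (k + 1) : ℕ))) * l1 (x' - ((Lc ^ (k + 1) : ℕ) : ℤ) • c)) := by
      intro x'
      rw [Real.norm_eq_abs, abs_of_pos (Real.exp_pos _)]
      have h := env_le_exp_l1 (d := d) hL1 (show 0 ≤ 2 * κ₁ by positivity) c x'
      have e : Real.exp (-(2 * κ₁) * supNorm (quo (Lc ^ (k + 1)) x' - c)) = Real.exp (-(2 * κ₁ * supNorm (quo (Lc ^ (k + 1)) x' - c))) := by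
        rw [neg_mul]
      show Real.exp (-(2 * κ₁) * supNorm (quo (Lc ^ (k + 1)) x' - c)) ≤ _
      rw [e]; exact h
    have hr : 0 < (2 * κ₁) / (((d : ℝ) + 1) * (Lc ^ (k + 1) : ℕ)) := by
      have : (0:ℝ) < ((Lc ^ (k + 1) : ℕ) : ℝ) := by exact_mod_cast hL1
      positivity
    exact Summable.of_norm_bounded ((summable_exp_shift' hr (((Lc ^ (k + 1) : ℕ) : ℤ) • c)).mul_left _) hb
  have hmaj : Summable fun x' => |A x'| * (CK * Z₂ * G (quo (Lc ^ (k + 1)) x')) := by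
    refine Summable.of_nonneg_of_le (fun x' => by positivity) (fun x' => ?_) ((hGq.mul_left (a * (CK * Z₂))))
    calc |A x'| * (CK * Z₂ * G (quo (Lc ^ (k + 1)) x')) ≤ a * (CK * Z₂ * G (quo (Lc ^ (k + 1)) x')) :=
          mul_le_mul_of_nonneg_right (hAb x') (by rw [hG]; positivity)
      _ = a * (CK * Z₂) * G (quo (Lc ^ (k + 1)) x') := by ring
  have hs1 : Summable fun x' => |A x'| * ∑ t ∈ box (d + 1) (Lc ^ (k + 2)), |M x' (((Lc ^ (k + 2) : ℕ) : ℤ) • c + toSite t)| :=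
    Summable.of_norm_bounded hmaj hdom
  have hstep2 : ∑' x', |A x'| * ∑ t ∈ box (d + 1) (Lc ^ (k + 2)), |M x' (((Lc ^ (k + 2) : ℕ) : ℤ) • c + toSite t)|
      ≤ ∑' x', |A x'| * (CK * Z₂ * G (quo (Lc ^ (k + 1)) x')) :=
    hs1.tsum_le_tsum (fun x' => mul_le_mul_of_nonneg_left (hMsum x') (abs_nonneg _)) hmaj
  -- regroup by blocks of side `N`
  have hblocks : ∑' x', |A x'| * (CK * Z₂ * G (quo (Lc ^ (k + 1)) x'))
      = ∑' c', ∑ s ∈ box (d + 1) (Lc ^ (k + 1)), |A (((Lc ^ (k + 1) : ℕ) : ℤ) • c' + toSite s)| * (CK * Z₂ * G (quo (Lc ^ (k + 1)) (((Lc ^ (k + 1) : ℕ) : ℤ) • c' + toSite s))) :=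
    tsum_blocks (N := Lc ^ (k + 1)) hmaj
  have hblk : ∀ c', ∑ s ∈ box (d + 1) (Lc ^ (k + 1)), |A (((Lc ^ (k + 1) : ℕ) : ℤ) • c' + toSite s)| * (CK * Z₂ * G (quo (Lc ^ (k + 1)) (((Lc ^ (k + 1) : ℕ) : ℤ) • c' + toSite s)))
      ≤ (a * CK * Z₂) * (E c' * G c') := by
    intro c'
    calc ∑ s ∈ box (d + 1) (Lc ^ (k + 1)), |A (((Lc ^ (k + 1) : ℕ) : ℤ) • c' + toSite s)| * (CK * Z₂ * G (quo (Lc ^ (k + 1)) (((Lc ^ (k + 1) : ℕ) : ℤ) • c' + toSite s)))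
        = ∑ s ∈ box (d + 1) (Lc ^ (k + 1)), |A (((Lc ^ (k + 1) : ℕ) : ℤ) • c' + toSite s)| * (CK * Z₂ * G c') :=
          Finset.sum_congr rfl fun s hs => by rw [quo_zsmul_add_toSite c' hs]
      _ = (∑ s ∈ box (d + 1) (Lc ^ (k + 1)), |A (((Lc ^ (k + 1) : ℕ) : ℤ) • c' + toSite s)|) * (CK * Z₂ * G c') := by rw [Finset.sum_mul]
      _ ≤ (a * E c') * (CK * Z₂ * G c') := mul_le_mul_of_nonneg_right (hA c') (by rw [hG]; positivity)
      _ = _ := by ring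
  -- the coarse sum: triangle inequality `E c' · G c' ≤ E c · e^{−κ₁‖c' − c‖}`
  have htri : ∀ c', E c' * G c' ≤ E c * Real.exp (-(κ₁ * supNorm (c' - c))) := by
    intro c'
    rw [hE, hG]
    simp only
    rw [← Real.exp_add, ← Real.exp_add, Real.exp_le_exp]
    have h1 : supNorm (c - z) ≤ supNorm (c' - z) + supNorm (c' - c) := by
      have h := supNorm_add_le (c' - z) (c - c')
      rw [show c' - z + (c - c') = c - z by abel] at h
      have h2 : supNorm (c - c') = supNorm (c' - c) := by
        unfold B4ContourShift.supNorm
        simp only [Pi.sub_apply, abs_sub_comm]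
      linarith
    have h0 : 0 ≤ supNorm (c' - c) := supNorm_nonneg _
    nlinarith
  have hcoarse_s : Summable fun c' => (a * CK * Z₂) * (E c' * G c') :=
    (Summable.of_nonneg_of_le (fun c' => by rw [hE, hG]; positivity) htri (hEnv.1.mul_left (E c))).mul_left _
  have hb := summable_blocks (N := Lc ^ (k + 1)) hmaj
  calc ∑ t ∈ box (d + 1) (Lc ^ (k + 2)), |∑' x', A x' * M x' (((Lc ^ (k + 2) : ℕ) : ℤ) • c + toSite t)|
      ≤ ∑' x', |A x'| * (CK * Z₂ * G (quo (Lc ^ (k + 1)) x')) := hstep.trans hstep2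
    _ = _ := hblocks
    _ ≤ ∑' c', (a * CK * Z₂) * (E c' * G c') := hb.tsum_le_tsum hblk hcoarse_s
    _ ≤ ∑' c', (a * CK * Z₂) * (E c * Real.exp (-(κ₁ * supNorm (c' - c)))) :=
        hcoarse_s.tsum_le_tsum (fun c' => mul_le_mul_of_nonneg_left (htri c') (by positivity))
          ((hEnv.1.mul_left (E c)).mul_left _)
    _ = (a * CK * Z₂) * E c * ∑' c', Real.exp (-(κ₁ * supNorm (c' - c))) := by
        rw [← tsum_mul_left]; exact tsum_congr fun c' => by ring
    _ ≤ (a * CK * Z₂) * E c * (Real.exp κ₁ * Zl (d + 1) (κ₁ / ((d : ℝ) + 1))) :=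
        mul_le_mul_of_nonneg_left hEnv.2 (by rw [hE]; positivity)
    _ = a * CK * Zl (d + 1) (δK / 2) * Real.exp (3 * κ₁) * Zl (d + 1) (κ₁ / ((d : ℝ) + 1)) * Real.exp (-(κ₁ * supNorm (c - z))) := by
        rw [hZ₂, hE]
        have e3 : Real.exp (3 * κ₁) = Real.exp (2 * κ₁) * Real.exp κ₁ := by rw [← Real.exp_add]; ring_nf
        rw [e3]; ring

end Summit.QuantumFields.BalabanUV.Beta.GAN24.DressedLegBlockL1MultiplierColumn

end
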